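import Summits.AtomisticToContinuum.Crystallization.Theses.ReggeStarCoercivity

/-!
# Negative knowledge for crux `DefectFreeCrystallizes` — STRAIN BLINDNESS of the 1/20-defect
# predicate, exactly: principal stretches in `[19/21, 21/19]` are invisible

`shellCloseTo_uniax`: a uniaxially strained copy (`x ↦ x + ε⟪n,x⟫n`, any unit axis `n`,
`−2/21 ≤ ε ≤ 2/19`) of a pattern of unit vectors, rescaled by `a = 1 + ε/2`, is `1/20`-close to the
pattern (the `ε/2` identity `norm_uniax_sub_sq`); `not_shellCloseTo_of_ratio`: a shell with two
radii of ratio `> 21/19` is not `1/20`-close to any pattern of unit vectors at any scale. So the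
hypothesis `ZeroDefectDensity` of `ReggeStarCoercivity.DefectFreeCrystallizes` does not see
uniaxial strains of `+10.5 % / −9.5 %`, and this window is sharp. Helper of independent use:
`etaMatched_image_of_dist_le`. Supports item stmt-AtomisticToContinuum-13603 (disprover, cycle 2).
-/

noncomputable section

namespace Summit.AtomisticToContinuum.Crystallization.Theorems.DefectFreeCrystallizes.Negative.StrainBlindness

open Literature.Geometry.DiscreteGeometry

/-- A matched image is `η`-matched: if `g` moves every point of `P` by at most `η` and is injective
on `P`, then `P.image g` is `η`-matched to `P`. [folklore] -/
theorem etaMatched_image_of_dist_le {η : ℝ} {P : Finset (EuclideanSpace ℝ (Fin 3))} (g : EuclideanSpace ℝ (Fin 3) → EuclideanSpace ℝ (Fin 3)) (hg : Set.InjOn g P)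
    (h : ∀ p ∈ P, dist (g p) p ≤ η) : EtaMatched η (P.image g) P := by
  classical
  have hex : ∀ t : ↥(P.image g), ∃ p ∈ P, g p = t := fun t => Finset.mem_image.1 t.2
  refine ⟨{ toFun := fun t => ⟨Classical.choose (hex t), (Classical.choose_spec (hex t)).1⟩
            invFun := fun p => ⟨g p, Finset.mem_image_of_mem g p.2⟩
            left_inv := fun t => Subtype.ext (Classical.choose_spec (hex t)).2
            right_inv := fun p => ?_ }, fun t => ?_⟩
  · apply Subtype.ext
    have h1 := Classical.choose_spec (hex ⟨g p, Finset.mem_image_of_mem g p.2⟩)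
    exact hg h1.1 p.2 h1.2
  · have h1 := Classical.choose_spec (hex t)
    show dist (t : EuclideanSpace ℝ (Fin 3)) (Classical.choose (hex t)) ≤ η
    have h3 := h _ h1.1
    rw [h1.2] at h3
    exact h3

/-- Hence `P.image g` is `η`-close to `P` (identity isometry). [folklore] -/
theorem shellCloseTo_image_of_dist_le {η : ℝ} {P : Finset (EuclideanSpace ℝ (Fin 3))} (g : EuclideanSpace ℝ (Fin 3) → EuclideanSpace ℝ (Fin 3)) (hg : Set.InjOn g P)
    (h : ∀ p ∈ P, dist (g p) p ≤ η) : ShellCloseTo η (P.image g) P :=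
  ⟨LinearIsometry.id, by simpa using etaMatched_image_of_dist_le g hg h⟩

/-- **The `ε/2` identity**: against the rescaling `1 + ε/2`, a uniaxial strain moves EVERY unit
vector by exactly `|ε|/2`, whatever its direction. [folklore] -/
theorem norm_uniax_sub_sq {ε : ℝ} {n p : EuclideanSpace ℝ (Fin 3)} (hn : ‖n‖ = 1) (hp : ‖p‖ = 1) :
    ‖(p + (ε * inner ℝ n p) • n) - (1 + ε / 2) • p‖ ^ 2 = (ε / 2) ^ 2 := by
  have h1 : (p + (ε * inner ℝ n p) • n) - (1 + ε / 2) • p = (ε * inner ℝ n p) • n - (ε / 2) • p := by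
    module
  rw [h1, @norm_sub_sq_real, norm_smul, norm_smul, hn, hp, inner_smul_left, inner_smul_right,
    Real.norm_eq_abs, Real.norm_eq_abs, mul_one, mul_one, sq_abs, sq_abs]
  simp only [starRingEnd_apply, star_trivial]
  ring

/-- `uniax ε n` is injective for `ε ≠ -1` (indeed for `1 + ε ≠ 0`) when `‖n‖ = 1`. [folklore] -/
theorem uniax_injective {ε : ℝ} {n : EuclideanSpace ℝ (Fin 3)} (hn : ‖n‖ = 1) (hε : 1 + ε ≠ 0) :
    Function.Injective (fun x => x + (ε * inner ℝ n x) • n) := by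
  intro x y hxy
  simp only at hxy
  have key : ∀ z : EuclideanSpace ℝ (Fin 3), (z + (ε * inner ℝ n z) • n) = 0 → z = 0 := by
    intro z hz
    have h1 : inner ℝ n ((z + (ε * inner ℝ n z) • n)) = (1 + ε) * inner ℝ n z := by
      simp only [inner_add_right, inner_smul_right, real_inner_self_eq_norm_sq, hn]; ring
    rw [hz, inner_zero_right] at h1
    have h2 : inner ℝ n z = 0 := by
      rcases mul_eq_zero.1 h1.symm with h | h
      · exact absurd h hε
      · exact h
    have : (z + (ε * inner ℝ n z) • n) = z := by simp [h2]
    rw [← this, hz]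
  have hlin : (x + (ε * inner ℝ n x) • n) - (y + (ε * inner ℝ n y) • n) = ((x - y) + (ε * inner ℝ n (x - y)) • n) := by
    simp only [inner_sub_right]; module
  have := key (x - y) (by rw [← hlin, hxy, sub_self])
  exact sub_eq_zero.1 this

/-- **Strain blindness (sufficiency).** For `−2/21 ≤ ε ≤ 2/19` and any unit direction `n`, the
uniaxially strained copy of a pattern `P` of unit vectors, rescaled by `a = 1 + ε/2` (admissible:
`a ∈ [20/21, 20/19]`), is `1/20`-close to `P`. [folklore] -/
theorem shellCloseTo_uniax {P : Finset (EuclideanSpace ℝ (Fin 3))} (hP : ∀ p ∈ P, ‖p‖ = 1) {ε : ℝ} (hε₁ : -2 / 21 ≤ ε)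
    (hε₂ : ε ≤ 2 / 19) {n : EuclideanSpace ℝ (Fin 3)} (hn : ‖n‖ = 1) :
    ShellCloseTo (1 / 20) ((P.image (fun x => x + (ε * inner ℝ n x) • n)).image fun v => (1 + ε / 2)⁻¹ • v) P := by
  have ha : 0 < 1 + ε / 2 := by linarith
  rw [Finset.image_image]
  refine shellCloseTo_image_of_dist_le _ ?_ ?_
  · intro p _ q _ hpq
    have h1 := smul_right_injective (EuclideanSpace ℝ (Fin 3)) (inv_ne_zero ha.ne') hpq
    exact uniax_injective hn (by linarith) h1
  · intro p hp
    have hid : ‖(1 + ε / 2)⁻¹ • (p + (ε * inner ℝ n p) • n) - p‖ = (1 + ε / 2)⁻¹ * ‖(p + (ε * inner ℝ n p) • n) - (1 + ε / 2) • p‖ := by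
      rw [← Real.norm_of_nonneg (inv_nonneg.2 ha.le), ← norm_smul, smul_sub, smul_smul,
        inv_mul_cancel₀ ha.ne', one_smul, Real.norm_of_nonneg (inv_nonneg.2 ha.le)]
    have hsq := norm_uniax_sub_sq (ε := ε) hn (hP p hp)
    have hnn : 0 ≤ ‖(p + (ε * inner ℝ n p) • n) - (1 + ε / 2) • p‖ := norm_nonneg _
    have heq : ‖(p + (ε * inner ℝ n p) • n) - (1 + ε / 2) • p‖ = |ε| / 2 := by
      have : ‖(p + (ε * inner ℝ n p) • n) - (1 + ε / 2) • p‖ ^ 2 = (|ε| / 2) ^ 2 := by rw [hsq, div_pow, div_pow, sq_abs]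
      rw [← Real.sqrt_sq hnn, this, Real.sqrt_sq (by positivity)]
    show dist _ _ ≤ _
    rw [dist_eq_norm, Function.comp_apply, hid, heq, inv_mul_le_iff₀ ha]
    rcases le_or_gt 0 ε with h | h
    · rw [abs_of_nonneg h]; linarith
    · rw [abs_of_neg h]; linarith

/-- **Strain blindness (sharpness, radial form).** A shell containing two vectors whose norms have
ratio `> 21/19` is not `1/20`-close, at ANY positive scale, to any pattern of unit vectors.
[folklore] -/
theorem not_shellCloseTo_of_ratio {S P : Finset (EuclideanSpace ℝ (Fin 3))} (hP : ∀ p ∈ P, ‖p‖ = 1) {u w : EuclideanSpace ℝ (Fin 3)}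
    (hu : u ∈ S) (hw : w ∈ S) (hratio : 21 / 19 * ‖u‖ < ‖w‖) {a : ℝ} (ha : 0 < a) :
    ¬ ShellCloseTo (1 / 20) (S.image fun v => a⁻¹ • v) P := by
  rintro ⟨A, e, he⟩
  have pin : ∀ v ∈ S, |‖v‖ - a| ≤ a * (1 / 20) := by
    intro v hv
    have ht : a⁻¹ • v ∈ S.image fun v => a⁻¹ • v := Finset.mem_image_of_mem _ hv
    obtain ⟨p, hp, hpq⟩ := Finset.mem_image.1 (e ⟨_, ht⟩).2
    have hqn : ‖((e ⟨_, ht⟩ : ↥(P.image A)) : EuclideanSpace ℝ (Fin 3))‖ = 1 := by rw [← hpq, A.norm_map, hP p hp]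
    have h1 : |‖a⁻¹ • v‖ - ‖((e ⟨_, ht⟩ : ↥(P.image A)) : EuclideanSpace ℝ (Fin 3))‖| ≤ 1 / 20 :=
      (abs_norm_sub_norm_le _ _).trans (by simpa [dist_eq_norm] using he ⟨_, ht⟩)
    rw [hqn, norm_smul, norm_inv, Real.norm_of_nonneg ha.le] at h1
    have hmul := mul_le_mul_of_nonneg_left h1 ha.le
    rw [← abs_of_pos ha, ← abs_mul, abs_of_pos ha] at hmul
    have : a * (a⁻¹ * ‖v‖ - 1) = ‖v‖ - a := by field_simp
    rwa [this] at hmul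
  have h1 := pin u hu
  have h2 := pin w hw
  rw [abs_le] at h1 h2
  have hu0 : 0 ≤ ‖u‖ := norm_nonneg u
  nlinarith [h1.1, h1.2, h2.1, h2.2]


end Summit.AtomisticToContinuum.Crystallization.Theorems.DefectFreeCrystallizes.Negative.StrainBlindness

end
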